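import Mathlib.Algebra.DirectSum.LinearMap
import Literature.NumberTheory.EllipticCurves.DeligneSerreWeightOneBound
import Literature.NumberTheory.EllipticCurves.NewformGaloisRepOddProofs
import Literature.NumberTheory.GaloisRepresentations.ArtinRepFrobeniusProofs
import HarnessLib

/-!
# Deligne–Serre 1974, §8.7: irreducibility of the weight-one representation

This file PROVES the named fact `Literature.NumberTheory.EllipticCurves.ModularForms.DeligneSerre1974.thm41_isIrreducible`
(`Literature.NumberTheory.EllipticCurves.NewformGaloisRepProofs`; Deligne–Serre 1974,
Thm. 4.1: the finite-image representation `ρ : Gal(ℚ̄/ℚ) → GL₂(ℂ)` attached to a weight-one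
newform — a cusp form — away from `N` is irreducible) from

* `Literature.NumberTheory.EllipticCurves.ModularForms.DeligneSerre1974.prop51` (op. cit. Prop. 5.1, Rankin):
  `∑_{p ∤ N} |a_p|² p^{-s} ≤ log (1/(s-1)) + O(1)`;
* `Literature.NumberTheory.LFunctions.Chebotarev.dirichletDensity_eq` (Chebotarev, Neukirch VII (13.4)) — used both for the
  oddness `det ρ(c) = −1` (the tree's `rem45_isOdd_of` of `NewformGaloisRepOddProofs`, fed with
  Lemme 3.2 in the form `lemma32_complex_of hCheb` of `ArtinRepFrobeniusProofs`) and, in place of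
  Dirichlet's theorem on `L(1, χ) ≠ 0` ("[21], VI.4.2" in the source), for the estimate
  `∑_p χ₁χ₂⁻¹(F_p) p^{-s} = o(log (1/(s-1)))` for the non-trivial finite-order character `χ₁χ₂⁻¹`;
* the newform facts `f ∈ S_1(N, ε)`, `T_p f = a_p f`.

## The argument (op. cit. 8.7)

Suppose `ρ` reducible. Being semisimple (finite image, Maschke), `ρ = χ₁ ⊕ χ₂` for two
characters with finite image (`exists_characters_of_not_isIrreducible`), so
`a_p = χ₁(F_p) + χ₂(F_p)` and `|a_p|² = 2 + 2 Re ψ(F_p)` with `ψ = χ₁χ₂⁻¹` (`p ∤ N`). The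
character `ψ` is non-trivial: otherwise `ρ(c)` would be scalar and `det ρ(c) = χ₁(c)² = 1`,
contradicting oddness. By Chebotarev, for each value `ω` of `ψ` the primes with `ψ(F_p) = ω`
have Dirichlet density `1/#ψ(Gal)`, and `∑_ω ω = 0`; hence
`∑_{p∤N} |a_p|² p^{-s} / log (1/(s-1)) → 2`, contradicting Prop. 5.1.

## References

* P. Deligne, J.-P. Serre, *Formes modulaires de poids 1*, Ann. Sci. ÉNS (4) 7 (1974), §8.7
  (p. 526–527), Prop. 5.1.
-/

noncomputable section

open scoped NumberField MatrixGroups Topology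
open IsDedekindDomain Rat.HeightOneSpectrum Field Polynomial Filter CongruenceSubgroup

namespace Literature.NumberTheory.EllipticCurves.ModularForms.DeligneSerre1974

/-! ### Endomorphisms of lines -/

section OneDim

variable {U : Type*} [AddCommGroup U] [Module ℂ U] [FiniteDimensional ℂ U]

/-- An endomorphism of a line is multiplication by its determinant. [folklore] -/
lemma eq_det_smul_id_of_finrank_eq_one (h : Module.finrank ℂ U = 1) (g : U →ₗ[ℂ] U) :
    g = LinearMap.det g • LinearMap.id := by
  let b := Module.finBasisOfFinrankEq ℂ U h
  have hg : g = Matrix.toLin b b (LinearMap.toMatrix b b g) := (Matrix.toLin_toMatrix b b g).symm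
  have hM : LinearMap.toMatrix b b g = (LinearMap.toMatrix b b g 0 0) • (1 : Matrix (Fin 1) (Fin 1) ℂ) := by
    ext i j
    fin_cases i; fin_cases j
    simp
  rw [← LinearMap.det_toMatrix b, Matrix.det_fin_one]
  conv_lhs => rw [hg, hM]
  rw [map_smul, Matrix.toLin_one]

/-- On a line, trace and determinant coincide. [folklore] -/
lemma trace_eq_det_of_finrank_eq_one (h : Module.finrank ℂ U = 1) (g : U →ₗ[ℂ] U) :
    LinearMap.trace ℂ U g = LinearMap.det g := by
  let b := Module.finBasisOfFinrankEq ℂ U h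
  rw [LinearMap.trace_eq_matrix_trace ℂ b, ← LinearMap.det_toMatrix b, Matrix.trace_fin_one,
    Matrix.det_fin_one]

end OneDim

/-! ### A reducible two-dimensional representation with finite image is a sum of two characters -/

section Decompose

variable {G : Type*} [Group G] [TopologicalSpace G]

/-- The representation on `ℂ²` underlying a framed representation is `toLin'` of the matrix.
[folklore] -/
lemma toRepresentation_apply_eq_toLin' {n : ℕ} (ρ : GaloisRepresentations.FramedRep G ℂ n) (g : G) :
    GaloisRepresentations.FramedRep.toRepresentation ρ g =
      Matrix.toLin' ((ρ g : GL (Fin n) ℂ) : Matrix (Fin n) (Fin n) ℂ) := by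
  refine LinearMap.ext fun v ↦ ?_
  simp [Matrix.toLin'_apply]

/-- **Deligne–Serre 1974, 8.7, first step.** A reducible continuous representation
`ρ : G → GL₂(ℂ)` with finite image is a direct sum of two characters: there are characters
`χ₁, χ₂ : G → ℂ` (of finite order, trivial on `ker ρ`) with `tr ρ(g) = χ₁(g) + χ₂(g)`; and if
`χ₁ = χ₂` then every `ρ(g)` is scalar, `det ρ(g) = χ₁(g)²`. (Semisimplicity by Maschke; the two
lines are an invariant line and an invariant complement.) [folklore] -/
theorem exists_characters_of_not_isIrreducible (ρ : GaloisRepresentations.FramedRep G ℂ 2)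
    (hfin : (Set.range ρ).Finite) (hirr : ¬ ρ.toContinuousRep.IsIrreducible) :
    ∃ χ₁ χ₂ : G →* ℂ,
      (∀ g, ((ρ g : GL (Fin 2) ℂ) : Matrix (Fin 2) (Fin 2) ℂ).trace = χ₁ g + χ₂ g) ∧
      (∀ g, ρ g = 1 → χ₁ g = 1 ∧ χ₂ g = 1) ∧
      (∀ g, χ₁ g ^ Nat.card (ρ : G →* GL (Fin 2) ℂ).range = 1 ∧
        χ₂ g ^ Nat.card (ρ : G →* GL (Fin 2) ℂ).range = 1) ∧
      ((∀ g, χ₁ g = χ₂ g) →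
        ∀ g, ((ρ g : GL (Fin 2) ℂ) : Matrix (Fin 2) (Fin 2) ℂ).det = χ₁ g ^ 2) := by
  classical
  set R : Representation ℂ G (Fin 2 → ℂ) := GaloisRepresentations.FramedRep.toRepresentation ρ with hRdef
  have hRapply : ∀ g, R g = Matrix.toLin' ((ρ g : GL (Fin 2) ℂ) : Matrix (Fin 2) (Fin 2) ℂ) :=
    toRepresentation_apply_eq_toLin' ρ
  -- semisimple (Maschke) and not irreducible: an invariant line with an invariant complement
  haveI hss : R.IsSemisimpleRepresentation := isSemisimple_of_finite_range ρ hfin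
  have hnt : Nontrivial (Subrepresentation R) := by
    refine ⟨⊥, ⊤, fun h ↦ ?_⟩
    have := congrArg Subrepresentation.toSubmodule h
    exact bot_ne_top (α := Submodule ℂ (Fin 2 → ℂ)) this
  obtain ⟨W, hWbot, hWtop⟩ : ∃ W : Subrepresentation R, W ≠ ⊥ ∧ W ≠ ⊤ := by
    by_contra! h
    exact hirr { toNontrivial := hnt, eq_bot_or_eq_top := fun W ↦ (em (W = ⊥)).imp_right (h W) }
  obtain ⟨W', hWW'⟩ := exists_isCompl W
  set U₁ : Submodule ℂ (Fin 2 → ℂ) := W.toSubmodule with hU₁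
  set U₂ : Submodule ℂ (Fin 2 → ℂ) := W'.toSubmodule with hU₂
  have hU : IsCompl U₁ U₂ := by
    refine ⟨disjoint_iff.mpr ?_, codisjoint_iff.mpr ?_⟩
    · exact congrArg Subrepresentation.toSubmodule (disjoint_iff.mp hWW'.1)
    · exact congrArg Subrepresentation.toSubmodule (codisjoint_iff.mp hWW'.2)
  -- dimensions
  have hV : Module.finrank ℂ (Fin 2 → ℂ) = 2 := Module.finrank_fin_fun ℂ
  have h1 : Module.finrank ℂ U₁ = 1 := by
    have hpos : 0 < Module.finrank ℂ U₁ := by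
      rw [Module.finrank_pos_iff_exists_ne_zero]
      by_contra! h
      apply hWbot
      apply Subrepresentation.toSubmodule_injective
      change U₁ = ⊥
      rw [Submodule.eq_bot_iff]
      intro x hx
      simpa using h ⟨x, hx⟩
    have hlt : Module.finrank ℂ U₁ < 2 :=
      (Submodule.finrank_lt fun h ↦ hWtop (Subrepresentation.toSubmodule_injective h)).trans_eq hV
    omega
  have h2 : Module.finrank ℂ U₂ = 1 := by
    have := Submodule.finrank_add_eq_of_isCompl hU
    omega
  -- the two characters
  let χ₁ : G →* ℂ := (LinearMap.det : (U₁ →ₗ[ℂ] U₁) →* ℂ).comp W.toRepresentation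
  let χ₂ : G →* ℂ := (LinearMap.det : (U₂ →ₗ[ℂ] U₂) →* ℂ).comp W'.toRepresentation
  have hχ₁ : ∀ g, χ₁ g = LinearMap.det ((R g).restrict (W.apply_mem_toSubmodule g)) := fun g ↦ rfl
  have hχ₂ : ∀ g, χ₂ g = LinearMap.det ((R g).restrict (W'.apply_mem_toSubmodule g)) := fun g ↦ rfl
  -- trace
  have hN : DirectSum.IsInternal ![U₁, U₂] := by
    rw [DirectSum.isInternal_submodule_iff_isCompl _ (i := (0 : Fin 2)) (j := 1) (by decide)
      (by ext i; fin_cases i <;> simp)]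
    exact hU
  have hmaps : ∀ g (i : Fin 2), Set.MapsTo (R g) (![U₁, U₂] i) (![U₁, U₂] i) := by
    intro g i
    fin_cases i
    · exact fun v hv ↦ W.apply_mem_toSubmodule g hv
    · exact fun v hv ↦ W'.apply_mem_toSubmodule g hv
  haveI : ∀ i : Fin 2, Module.Finite ℂ (![U₁, U₂] i) := fun i ↦ by
    fin_cases i
    · change Module.Finite ℂ U₁; infer_instance
    · change Module.Finite ℂ U₂; infer_instance
  haveI : ∀ i : Fin 2, Module.Free ℂ (![U₁, U₂] i) := fun i ↦ by
    fin_cases i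
    · change Module.Free ℂ U₁; infer_instance
    · change Module.Free ℂ U₂; infer_instance
  have htr : ∀ g, ((ρ g : GL (Fin 2) ℂ) : Matrix (Fin 2) (Fin 2) ℂ).trace = χ₁ g + χ₂ g := by
    intro g
    rw [← Matrix.trace_toLin'_eq, ← hRapply, LinearMap.trace_eq_sum_trace_restrict hN (hmaps g),
      Fin.sum_univ_two, hχ₁, hχ₂]
    exact congrArg₂ (· + ·) (trace_eq_det_of_finrank_eq_one h1 _)
      (trace_eq_det_of_finrank_eq_one h2 _)
  -- kernel
  have hker : ∀ g, ρ g = 1 → χ₁ g = 1 ∧ χ₂ g = 1 := by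
    intro g hg
    have hR1 : R g = 1 := by
      rw [hRapply, hg]
      simp only [Units.val_one, Matrix.toLin'_one]
      rfl
    have e1 : (R g).restrict (W.apply_mem_toSubmodule g) = LinearMap.id := by
      ext v; simp [LinearMap.restrict_apply, hR1]
    have e2 : (R g).restrict (W'.apply_mem_toSubmodule g) = LinearMap.id := by
      ext v; simp [LinearMap.restrict_apply, hR1]
    rw [hχ₁, hχ₂, e1, e2]
    exact ⟨LinearMap.det_id, LinearMap.det_id⟩
  -- finite order
  have hord : ∀ g, χ₁ g ^ Nat.card (ρ : G →* GL (Fin 2) ℂ).range = 1 ∧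
      χ₂ g ^ Nat.card (ρ : G →* GL (Fin 2) ℂ).range = 1 := by
    intro g
    have h1 : (⟨ρ g, g, rfl⟩ : (ρ : G →* GL (Fin 2) ℂ).range) ^
        Nat.card (ρ : G →* GL (Fin 2) ℂ).range = 1 := pow_card_eq_one'
    have h2 : ρ (g ^ Nat.card (ρ : G →* GL (Fin 2) ℂ).range) = 1 := by
      have := congrArg Subtype.val h1
      rw [Subgroup.coe_pow, Subgroup.coe_one] at this
      rw [map_pow]
      exact this
    obtain ⟨e1, e2⟩ := hker _ h2
    rw [map_pow] at e1 e2
    exact ⟨e1, e2⟩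
  -- scalar case
  have hscal : (∀ g, χ₁ g = χ₂ g) →
      ∀ g, ((ρ g : GL (Fin 2) ℂ) : Matrix (Fin 2) (Fin 2) ℂ).det = χ₁ g ^ 2 := by
    intro heq g
    have hRg : R g = χ₁ g • LinearMap.id := by
      have e1 := eq_det_smul_id_of_finrank_eq_one h1 ((R g).restrict (W.apply_mem_toSubmodule g))
      have e2 := eq_det_smul_id_of_finrank_eq_one h2 ((R g).restrict (W'.apply_mem_toSubmodule g))
      rw [← hχ₁] at e1
      rw [← hχ₂, ← heq] at e2
      refine LinearMap.ext fun v ↦ ?_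
      have hv : v ∈ U₁ ⊔ U₂ := by rw [codisjoint_iff.mp hU.2]; exact Submodule.mem_top
      obtain ⟨u₁, hu₁, u₂, hu₂, rfl⟩ := Submodule.mem_sup.mp hv
      have f1 : R g u₁ = χ₁ g • u₁ := by
        have := congrArg (fun T : U₁ →ₗ[ℂ] U₁ ↦ ((T ⟨u₁, hu₁⟩ : U₁) : Fin 2 → ℂ)) e1
        simpa [LinearMap.restrict_apply] using this
      have f2 : R g u₂ = χ₁ g • u₂ := by
        have := congrArg (fun T : U₂ →ₗ[ℂ] U₂ ↦ ((T ⟨u₂, hu₂⟩ : U₂) : Fin 2 → ℂ)) e2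
        simpa [LinearMap.restrict_apply] using this
      simp [map_add, f1, f2]
    have hM : ((ρ g : GL (Fin 2) ℂ) : Matrix (Fin 2) (Fin 2) ℂ) = χ₁ g • (1 : Matrix (Fin 2) (Fin 2) ℂ) := by
      apply Matrix.toLin'.injective
      rw [← hRapply, hRg, map_smul, Matrix.toLin'_one]
    rw [hM, Matrix.det_smul, Matrix.det_one, mul_one, Fintype.card_fin]
  exact ⟨χ₁, χ₂, htr, hker, hord, hscal⟩

end Decompose


/-! ### Analytic bookkeeping -/

section Analytic

open Classical in
/-- Dirichlet densities are insensitive to finitely many primes. [folklore] -/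
lemma hasDirichletDensity_of_finite {X Y T : Set ℕ} (hT : T.Finite)
    (h : ∀ p : ℕ, p.Prime → p ∉ T → (p ∈ X ↔ p ∈ Y)) {d : ℝ} (hX : LFunctions.HasDirichletDensity X d) :
    LFunctions.HasDirichletDensity Y d := by
  unfold LFunctions.HasDirichletDensity at hX ⊢
  have hT0 := LFunctions.PrimeSum.tendsto_div_log_zero_of_finite T hT
  have hup := hX.add hT0
  have hlo := hX.sub hT0
  rw [add_zero] at hup
  rw [sub_zero] at hlo
  refine tendsto_of_tendsto_of_tendsto_of_le_of_le' hlo hup ?_ ?_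
  · filter_upwards [LFunctions.PrimeSum.eventually_log_pos, LFunctions.PrimeSum.eventually_one_lt] with s hlog hs
    have hle := LFunctions.PrimeSum.le_add (Z := X) (X := Y) (Y := T) (fun p hp hpX ↦ by
      by_cases hpT : p ∈ T
      · exact Or.inr hpT
      · exact Or.inl ((h p hp hpT).mp hpX)) hs
    rw [← sub_div, div_le_div_iff_of_pos_right hlog]
    linarith
  · filter_upwards [LFunctions.PrimeSum.eventually_log_pos, LFunctions.PrimeSum.eventually_one_lt] with s hlog hs
    have hle := LFunctions.PrimeSum.le_add (Z := Y) (X := X) (Y := T) (fun p hp hpY ↦ by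
      by_cases hpT : p ∈ T
      · exact Or.inr hpT
      · exact Or.inl ((h p hp hpT).mpr hpY)) hs
    rw [← add_div, div_le_div_iff_of_pos_right hlog]
    exact hle

/-- The set of all primes has Dirichlet density `1`. [folklore] -/
lemma hasDirichletDensity_univ : LFunctions.HasDirichletDensity (Set.univ : Set ℕ) 1 := by
  unfold LFunctions.HasDirichletDensity
  simpa using LFunctions.PrimeSum.tendsto_univ_div_log

/-- The set of primes not dividing `N ≠ 0` has Dirichlet density `1`. [folklore] -/
lemma hasDirichletDensity_not_dvd {N : ℕ} (hN : N ≠ 0) :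
    LFunctions.HasDirichletDensity {p : ℕ | ¬ p ∣ N} 1 := by
  refine hasDirichletDensity_of_finite (X := Set.univ) (T := {p | p ∣ N}) ?_ (fun p _ hp ↦ ?_)
    hasDirichletDensity_univ
  · exact (Set.finite_Iic N).subset fun p hp ↦ Nat.le_of_dvd (Nat.pos_of_ne_zero hN) hp
  · simpa using hp

/-- The elements of a non-trivial finite subgroup of `ℂˣ` sum to zero. [folklore] -/
lemma sum_coe_eq_zero_of_ne_one {G : Subgroup ℂˣ} [Fintype G] {g₀ : G} (hg₀ : g₀ ≠ 1) :
    ∑ ω : G, ((ω : ℂˣ) : ℂ) = 0 := by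
  set S := ∑ ω : G, ((ω : ℂˣ) : ℂ) with hS
  have h1 : ((g₀ : ℂˣ) : ℂ) * S = S := by
    rw [hS, Finset.mul_sum]
    exact Fintype.sum_equiv (Equiv.mulLeft g₀) _ _ fun ω ↦ by simp
  have h2 : (((g₀ : ℂˣ) : ℂ) - 1) * S = 0 := by rw [sub_mul, one_mul, h1, sub_self]
  rcases mul_eq_zero.mp h2 with h | h
  · exact absurd (Units.val_eq_one.mp (sub_eq_zero.mp h)) (by simpa using hg₀)
  · exact h

open Classical in
/-- **The contradiction of Deligne–Serre 1974, 8.7, abstract form.** Suppose that for `s > 1`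
the terms `T(s, p)` decompose as `2·𝟙_U(p) p^{-s} + 2 ∑_ω w_ω 𝟙_{X_ω}(p) p^{-s}` where `U` has
Dirichlet density `1`, each `X_ω` has the same density `d` and `∑_ω w_ω = 0`. Then
`∑_p T(s, p) / log (1/(s-1)) → 2`, so `∑_p T(s, p) ≤ log (1/(s-1)) + O(1)` is impossible.
[cite: DeligneSerreASENS1974, §8.7] -/
theorem false_of_rankin_bound {T : ℝ → ℕ → ℝ} {Ω : Type*} [Fintype Ω] (w : Ω → ℝ)
    (hw : ∑ ω, w ω = 0) (X : Ω → Set ℕ) {d : ℝ} (hX : ∀ ω, LFunctions.HasDirichletDensity (X ω) d)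
    (U : Set ℕ) (hU : LFunctions.HasDirichletDensity U 1)
    (hT : ∀ s : ℝ, 1 < s → ∀ p : ℕ, T s p =
      2 * (if p.Prime ∧ p ∈ U then (p : ℝ) ^ (-s) else 0) +
        2 * ∑ ω, w ω * (if p.Prime ∧ p ∈ X ω then (p : ℝ) ^ (-s) else 0))
    (C : ℝ) (hbound : ∀ᶠ s : ℝ in 𝓝[>] (1 : ℝ), ∑' p, T s p ≤ Real.log (1 / (s - 1)) + C) :
    False := by
  have hX' : ∀ ω, Tendsto (fun s : ℝ ↦ (∑' p : ℕ, (if p.Prime ∧ p ∈ X ω then (p : ℝ) ^ (-s)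
      else 0)) / Real.log (1 / (s - 1))) (𝓝[>] (1 : ℝ)) (𝓝 d) := fun ω ↦ hX ω
  have hU' : Tendsto (fun s : ℝ ↦ (∑' p : ℕ, (if p.Prime ∧ p ∈ U then (p : ℝ) ^ (-s)
      else 0)) / Real.log (1 / (s - 1))) (𝓝[>] (1 : ℝ)) (𝓝 1) := hU
  -- the prime sum of `T`
  have hsum : ∀ s : ℝ, 1 < s → ∑' p, T s p =
      2 * (∑' p : ℕ, (if p.Prime ∧ p ∈ U then (p : ℝ) ^ (-s) else 0)) +
        2 * ∑ ω, w ω * (∑' p : ℕ, (if p.Prime ∧ p ∈ X ω then (p : ℝ) ^ (-s) else 0)) := by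
    intro s hs
    have h1 : Summable (fun p : ℕ ↦ if p.Prime ∧ p ∈ U then (p : ℝ) ^ (-s) else 0) :=
      LFunctions.PrimeSum.summable U hs
    have h2 : ∀ ω, Summable (fun p : ℕ ↦
        w ω * (if p.Prime ∧ p ∈ X ω then (p : ℝ) ^ (-s) else 0)) :=
      fun ω ↦ (LFunctions.PrimeSum.summable (X ω) hs).mul_left (w ω)
    have h3 : Summable (fun p : ℕ ↦
        ∑ ω, w ω * (if p.Prime ∧ p ∈ X ω then (p : ℝ) ^ (-s) else 0)) :=
      summable_sum fun ω _ ↦ h2 ω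
    rw [tsum_congr (hT s hs), (h1.mul_left 2).tsum_add (h3.mul_left 2), tsum_mul_left,
      tsum_mul_left, Summable.tsum_finsetSum (fun ω _ ↦ h2 ω)]
    simp only [tsum_mul_left]
  -- its asymptotic: `→ 2`
  have hlim : Tendsto (fun s : ℝ ↦ (∑' p, T s p) / Real.log (1 / (s - 1))) (𝓝[>] (1 : ℝ))
      (𝓝 2) := by
    have e := (hU'.const_mul 2).add
      ((tendsto_finsetSum Finset.univ fun ω _ ↦ (hX' ω).const_mul (w ω)).const_mul 2)
    have h2 : (2 : ℝ) * 1 + 2 * ∑ ω, w ω * d = 2 := by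
      rw [← Finset.sum_mul, hw]; ring
    rw [h2] at e
    refine e.congr' ?_
    filter_upwards [LFunctions.PrimeSum.eventually_one_lt] with s hs
    rw [hsum s hs]
    simp only [add_div, mul_div_assoc, Finset.sum_div]
  -- the bound: `≤ 1 + C / log`, whose limit is `1`
  have hlim1 : Tendsto (fun s : ℝ ↦ 1 + C / Real.log (1 / (s - 1))) (𝓝[>] (1 : ℝ)) (𝓝 1) := by
    have := (tendsto_const_nhds (x := C)).div_atTop LFunctions.PrimeSum.tendsto_log_one_div_sub_one
    simpa using this.const_add 1
  have hle : ∀ᶠ s : ℝ in 𝓝[>] (1 : ℝ),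
      (∑' p, T s p) / Real.log (1 / (s - 1)) ≤ 1 + C / Real.log (1 / (s - 1)) := by
    filter_upwards [hbound, LFunctions.PrimeSum.eventually_log_pos] with s hb hlog
    rw [div_le_iff₀ hlog, add_mul, one_mul, div_mul_cancel₀ _ hlog.ne']
    exact hb
  have := le_of_tendsto_of_tendsto hlim hlim1 hle
  norm_num at this

end Analytic

/-! ### Thm. 4.1 (irreducibility) -/

section Irreducible

variable {N : ℕ} [NeZero N]

/-- `‖u + w‖² = 2 + 2 Re(u w⁻¹)` for `u, w` on the unit circle. [folklore] -/
lemma norm_add_sq_of_norm_eq_one {u w : ℂ} (hu : ‖u‖ = 1) (hw : ‖w‖ = 1) :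
    ‖u + w‖ ^ 2 = 2 + 2 * (u * w⁻¹).re := by
  rw [Complex.sq_norm, Complex.normSq_add, Complex.normSq_eq_norm_sq, Complex.normSq_eq_norm_sq,
    hu, hw, Complex.inv_eq_conj hw]
  ring

/-- The trace of a `2 × 2` matrix with characteristic polynomial `X² − a X + b` is `a`.
[folklore] -/
lemma trace_eq_of_charpoly_eq {M : Matrix (Fin 2) (Fin 2) ℂ} {a b : ℂ}
    (h : M.charpoly = X ^ 2 - C a * X + C b) : M.trace = a := by
  rw [Matrix.trace_eq_neg_charpoly_coeff, h]
  simp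

open Classical in
/-- **Deligne–Serre 1974, Thm. 4.1 (irreducibility), from Prop. 5.1, Chebotarev and the parity
of `ε`** (op. cit. 8.7). For a newform `f ∈ S_1(Γ₁(N))` every finite-image representation
`ρ : Gal(ℚ̄/ℚ) → GL₂(ℂ)` attached to `f` away from `N` is irreducible: otherwise `ρ = χ₁ ⊕ χ₂`
with `ψ = χ₁χ₂⁻¹ ≠ 1` (oddness), `|a_p|² = 2 + 2 Re ψ(F_p)` for `p ∤ N`, and Chebotarev gives
`∑_{p∤N} |a_p|² p^{-s} ∼ 2 log (1/(s-1))`, contradicting Rankin's bound (5.1.1). This discharges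
the named fact `thm41_isIrreducible` modulo `prop51`, `Chebotarev.dirichletDensity_eq` and the
newform facts `f ∈ S_1(N, ε)`, `T_p f = a_p f`.
[cite: DeligneSerreASENS1974, Thm. 4.1 and §8.7] -/
theorem thm41_isIrreducible_of (h51 : prop51) (hCheb : LFunctions.Chebotarev.dirichletDensity_eq.{0})
    (hneb : IsNewform1.mem_nebentypusSubspace_nebentypus (N := N) (k := 1))
    (heig : IsNewform1.heckeEigenvalue_eq_coeff (N := N) (k := 1)) :
    thm41_isIrreducible (N := N) := by
  intro f hf ρ hρ hfin
  by_contra hirr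
  obtain ⟨χ₁, χ₂, htr, hker, hord, hscal⟩ := exists_characters_of_not_isIrreducible ρ hfin hirr
  haveI : Finite (ρ : absoluteGaloisGroup ℚ →* GL (Fin 2) ℂ).range :=
    Set.Finite.to_subtype (s := ((ρ : absoluteGaloisGroup ℚ →* GL (Fin 2) ℂ).range :
      Set (GL (Fin 2) ℂ))) (by rw [MonoidHom.coe_range]; exact hfin)
  haveI : Inhabited (absoluteGaloisGroup ℚ) := ⟨1⟩
  set n := Nat.card (ρ : absoluteGaloisGroup ℚ →* GL (Fin 2) ℂ).range with hndef
  have hn : n ≠ 0 := Nat.card_pos.ne'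
  have hnorm₁ : ∀ g, ‖χ₁ g‖ = 1 := fun g ↦ Complex.norm_eq_one_of_pow_eq_one (hord g).1 hn
  have hnorm₂ : ∀ g, ‖χ₂ g‖ = 1 := fun g ↦ Complex.norm_eq_one_of_pow_eq_one (hord g).2 hn
  have hne₂ : ∀ g, χ₂ g ≠ 0 := fun g ↦ by rw [← norm_ne_zero_iff, hnorm₂]; exact one_ne_zero
  -- `ψ = χ₁ χ₂⁻¹`
  set ψ : absoluteGaloisGroup ℚ →* ℂˣ := χ₁.toHomUnits * (χ₂.toHomUnits)⁻¹ with hψdef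
  have hψ : ∀ g, (ψ g : ℂ) = χ₁ g * (χ₂ g)⁻¹ := fun g ↦ by
    simp [hψdef]
  have hψker : ∀ g, ρ g = 1 → ψ g = 1 := fun g hg ↦ by
    ext; rw [hψ, (hker g hg).1, (hker g hg).2]; simp
  -- (1) `ψ` is non-trivial, by oddness
  have hf0 : f ≠ 0 := ne_zero_of_isNormalized hf.2.2.2
  obtain ⟨c, hc⟩ := GaloisRepresentations.exists_isComplexConjugation (Rat.castHom ℝ)
  have hodd := rem45_isOdd_of (Literature.NumberTheory.GaloisRepresentations.DeligneSerre1974.lemma32_complex_of hCheb) hf ρ hρ hfin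
    (Rat.castHom ℝ) c hc
  obtain ⟨σ₁, hσ₁⟩ : ∃ σ, ψ σ ≠ 1 := by
    by_contra! hall
    have heq : ∀ g, χ₁ g = χ₂ g := fun g ↦ by
      have := congrArg Units.val (hall g)
      rw [hψ, Units.val_one, mul_inv_eq_one₀ (hne₂ g)] at this
      exact this
    have hdet := hscal heq c
    have h1 : χ₁ c ^ 2 = 1 := by rw [← map_pow, hc.sq_eq_one, map_one]
    have h2 : ((ρ c : GL (Fin 2) ℂ) : Matrix (Fin 2) (Fin 2) ℂ).det = -1 := by
      rw [← Matrix.GeneralLinearGroup.val_det_apply, hodd, Units.val_neg, Units.val_one]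
    rw [hdet, h1] at h2
    norm_num at h2
  -- (2) Frobenii: a choice `σ p` at each prime `p`
  have hvp : ∀ (p : ℕ) (hp : p.Prime),
      ((primesEquiv (primesEquiv.symm ⟨p, hp⟩ : HeightOneSpectrum (𝓞 ℚ)) : Nat.Primes) : ℕ)
        = p := fun p hp ↦ by simp
  choose 𝔓 h𝔓 using fun (p : ℕ) (hp : p.Prime) ↦
    HeightOneSpectrum.primesAbove_nonempty (primesEquiv.symm ⟨p, hp⟩ : HeightOneSpectrum (𝓞 ℚ))
  choose σ hσ using fun (p : ℕ) (hp : p.Prime) ↦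
    HeightOneSpectrum.exists_isArithFrobAt_of_mem_primesAbove_holds (h𝔓 p hp)
  set frobVal : ℕ → ℂˣ := fun p ↦ if hp : p.Prime then ψ (σ p hp) else 1 with hfrobVal
  -- `ψ` is unramified at `p ∤ N` and constant on the Frobenii there
  have hunr : ∀ (p : ℕ) (hp : p.Prime), ¬ p ∣ N →
      ∀ Q ∈ (primesEquiv.symm ⟨p, hp⟩ : HeightOneSpectrum (𝓞 ℚ)).primesAbove,
        ∀ τ ∈ Q.inertia (absoluteGaloisGroup ℚ), ψ τ = 1 := by
    intro p hp hpN Q hQ τ hτ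
    have hv : ((primesEquiv (primesEquiv.symm ⟨p, hp⟩ : HeightOneSpectrum (𝓞 ℚ)) :
        Nat.Primes) : ℕ) ∉ {q | q ∣ N} := by rw [hvp]; exact hpN
    exact hψker τ ((hρ _ hv).1 Q hQ τ hτ)
  have hconst : ∀ (p : ℕ) (hp : p.Prime), ¬ p ∣ N →
      ∀ Q ∈ (primesEquiv.symm ⟨p, hp⟩ : HeightOneSpectrum (𝓞 ℚ)).primesAbove,
        ∀ τ : absoluteGaloisGroup ℚ, IsArithFrobAt (𝓞 ℚ) τ Q → ψ τ = frobVal p := by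
    intro p hp hpN Q hQ τ hτ
    obtain ⟨γ, -, hγ⟩ := HeightOneSpectrum.exists_isArithFrobAt_conj_of_mem_primesAbove_holds
      (h𝔓 p hp) hQ (hσ p hp)
    have hin := hτ.mul_inv_mem_inertia hγ
    have h1 := hunr p hp hpN Q hQ _ hin
    rw [map_mul, map_inv, mul_inv_eq_one] at h1
    rw [h1, map_mul, map_mul, map_inv, mul_comm (ψ γ) _, mul_inv_cancel_right]
    simp only [hfrobVal, dif_pos hp]
  -- (3) `|a_p|² = 2 + 2 Re ψ(F_p)` for `p ∤ N`
  have hap : ∀ (p : ℕ) (hp : p.Prime), ¬ p ∣ N →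
      ‖heckeEigenvalue f p‖ ^ 2 = 2 + 2 * ((frobVal p : ℂˣ) : ℂ).re := by
    intro p hp hpN
    have hv : ((primesEquiv (primesEquiv.symm ⟨p, hp⟩ : HeightOneSpectrum (𝓞 ℚ)) :
        Nat.Primes) : ℕ) ∉ {q | q ∣ N} := by rw [hvp]; exact hpN
    have hch := (hρ _ hv).2 _ (h𝔓 p hp) _ (hσ p hp)
    rw [hvp] at hch
    simp only [GaloisRepresentations.FramedRep.charpoly, map_heckePolynomial] at hch
    have htr' := trace_eq_of_charpoly_eq hch
    rw [htr, ← heig hf hp] at htr'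
    rw [← htr', norm_add_sq_of_norm_eq_one (hnorm₁ _) (hnorm₂ _), ← hψ]
    simp only [hfrobVal, dif_pos hp]
  -- (4) Chebotarev data: the values of `ψ`, the sets `X_ω`
  set Gψ := ψ.range with hGψ
  haveI : Finite Gψ := by
    obtain ⟨F, hF⟩ := exists_image_subset_of_factors (s := Set.univ) ψ ρ (fun g _ g' _ hgg' ↦ by
      have : ρ (g' * g⁻¹) = 1 := by rw [map_mul, map_inv, ← hgg', mul_inv_cancel]
      have h := hψker _ this
      rw [map_mul, map_inv, mul_inv_eq_one] at h
      exact h.symm)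
    have hfin' : (Set.range ψ).Finite := by
      rw [← Set.image_univ]
      exact ((hfin.subset (Set.image_subset_range _ _)).image F).subset hF
    exact Set.Finite.to_subtype (s := (Gψ : Set ℂˣ)) (by rw [hGψ, MonoidHom.coe_range]; exact hfin')
  letI : Fintype Gψ := Fintype.ofFinite Gψ
  set φ : absoluteGaloisGroup ℚ →* Gψ := ψ.rangeRestrict with hφdef
  have hφsurj : Function.Surjective φ := MonoidHom.rangeRestrict_surjective ψ
  have hφker : IsOpen ((φ.ker : Subgroup (absoluteGaloisGroup ℚ)) : Set (absoluteGaloisGroup ℚ)) := by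
    have h1 : IsOpen (((ρ : absoluteGaloisGroup ℚ →* GL (Fin 2) ℂ).ker :
        Subgroup (absoluteGaloisGroup ℚ)) : Set (absoluteGaloisGroup ℚ)) := by
      have : (((ρ : absoluteGaloisGroup ℚ →* GL (Fin 2) ℂ).ker :
          Subgroup (absoluteGaloisGroup ℚ)) : Set (absoluteGaloisGroup ℚ)) = ρ ⁻¹' {1} := by
        ext τ; simp [MonoidHom.mem_ker]
      rw [this]
      exact Literature.NumberTheory.GaloisRepresentations.DeligneSerre1974.isOpen_fiber_of_finite_range ρ.continuous hfin 1
    refine Subgroup.isOpen_mono (fun τ hτ ↦ ?_) h1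
    rw [MonoidHom.mem_ker] at hτ ⊢
    exact Subtype.ext (by rw [hφdef, MonoidHom.coe_rangeRestrict, hψker τ hτ]; rfl)
  set Xs : Gψ → Set ℕ := fun ω ↦ {p | p ∈ LFunctions.Chebotarev.frobPrimes φ {ω} ∧ ¬ p ∣ N} with hXs
  have hXdens : ∀ ω, LFunctions.HasDirichletDensity (Xs ω) (1 / Nat.card Gψ) := by
    intro ω
    have h := hCheb φ hφker hφsurj {ω} (fun g h hh ↦ by
      rw [Set.mem_singleton_iff] at hh ⊢
      rw [hh, mul_comm, inv_mul_cancel_left])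
    rw [Nat.card_unique, Nat.cast_one] at h
    refine hasDirichletDensity_of_finite (T := {p | p ∣ N}) ?_ (fun p _ hp ↦ ?_) h
    · exact (Set.finite_Iic N).subset fun p hp ↦ Nat.le_of_dvd (Nat.pos_of_neZero N) hp
    · simp only [hXs, Set.mem_setOf_eq]
      exact ⟨fun h ↦ ⟨h, hp⟩, fun h ↦ h.1⟩
  -- membership in `X_ω` for `p ∤ N`
  have hmemX : ∀ (p : ℕ) (hp : p.Prime), ¬ p ∣ N → ∀ ω : Gψ,
      p ∈ Xs ω ↔ ω = φ (σ p hp) := by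
    intro p hp hpN ω
    simp only [hXs, Set.mem_setOf_eq, hpN, not_false_eq_true, and_true]
    constructor
    · rintro ⟨v, hv, -, hfrob⟩
      have hv' : v = primesEquiv.symm ⟨p, hp⟩ := by
        apply primesEquiv.injective
        rw [Equiv.apply_symm_apply]
        exact Subtype.ext hv
      subst hv'
      exact (hfrob _ (h𝔓 p hp) _ (hσ p hp)).symm
    · rintro rfl
      refine ⟨primesEquiv.symm ⟨p, hp⟩, hvp p hp, fun Q hQ τ hτ ↦ ?_, fun Q hQ τ hτ ↦ ?_⟩
      · exact Subtype.ext (by rw [hφdef, MonoidHom.coe_rangeRestrict, hunr p hp hpN Q hQ τ hτ]; rfl)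
      · rw [Set.mem_singleton_iff]
        exact Subtype.ext (by
          rw [hφdef, MonoidHom.coe_rangeRestrict, MonoidHom.coe_rangeRestrict,
            hconst p hp hpN Q hQ τ hτ]
          simp only [hfrobVal, dif_pos hp])
  -- (5) Rankin's bound
  have heigen : ∀ p : ℕ, (hp : p.Prime) → ¬ p ∣ N →
      ∃ a : ℂ, (haveI : NeZero p := ⟨hp.ne_zero⟩; heckeT (Gamma1 N) 1 p f) = a • f :=
    fun p hp _ ↦ hf.2.1 p hp
  obtain ⟨-, C, hC⟩ := h51 (nebentypus f) f (hneb hf) hf0 heigen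
  simp only [Int.cast_one] at hC
  -- (6) the contradiction
  refine false_of_rankin_bound (T := rankinTerm f) (fun ω : Gψ ↦ ((ω : ℂˣ) : ℂ).re) ?_ Xs
    hXdens {p | ¬ p ∣ N} (hasDirichletDensity_not_dvd (NeZero.ne N)) ?_ C hC
  · rw [← Complex.re_sum, sum_coe_eq_zero_of_ne_one (G := Gψ) (g₀ := ⟨ψ σ₁, σ₁, rfl⟩) ?_,
      Complex.zero_re]
    intro h
    exact hσ₁ (congrArg Subtype.val h)
  · intro s hs p
    by_cases hp : p.Prime ∧ ¬ p ∣ N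
    · obtain ⟨hp, hpN⟩ := hp
      have hL : rankinTerm f s p = ‖heckeEigenvalue f p‖ ^ 2 * (p : ℝ) ^ (-s) := by
        simp [rankinTerm, hp, hpN]
      have e : ((φ (σ p hp) : Gψ) : ℂˣ) = frobVal p := by
        rw [hφdef, MonoidHom.coe_rangeRestrict]
        simp only [hfrobVal, dif_pos hp]
      rw [hL, hap p hp hpN, if_pos ⟨hp, hpN⟩]
      simp only [hp, true_and, hmemX p hp hpN, mul_ite, mul_zero, Finset.sum_ite_eq',
        Finset.mem_univ, if_true, e]
      ring
    · have hL : rankinTerm f s p = 0 := by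
        simp only [rankinTerm, hp, if_false]
      rw [hL]
      by_cases hp' : p.Prime
      · have hpN : p ∣ N := by
          by_contra h
          exact hp ⟨hp', h⟩
        have h2 : ∀ ω : Gψ, p ∉ Xs ω := fun ω h ↦ h.2 hpN
        simp [Set.mem_setOf_eq, hpN, h2]
      · simp [hp']

end Irreducible

end Literature.NumberTheory.EllipticCurves.ModularForms.DeligneSerre1974
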